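import Mathlib
import HarnessLib
import Summits.Ventures.LatticeQCDFlow.Exactness.LazyRelaxationGranularity

/-!
# Granularity versus relaxation at a fixed sweep budget, general refinement factor `r` (lazy layers)

HONEST FRAMING: exact (Metropolis-corrected) sampling algorithms for lattice gauge theory;
figures of merit are autocorrelation/cost numbers at stated couplings and volumes; no
continuum-physics claim.

Venture `LatticeQCDFlow` (cell pub-lqcd), topic `Exactness`, FANOUT row 8 (s0-cpn-nemc, GEN-6).
OUR WORK (elementary finite sums and one polynomial inequality), nothing cited as a fact.
`Exactness/LazyRelaxationGranularity.lean` (GEN-5) typed the case `r = 2` of the design lever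
"buy granularity, not relaxation" at a FIXED sweep budget (`lazyDissipation_halving_le`); this file
proves it for EVERY refinement factor `r ≥ 1`, and adds the general-`r` form of the quasi-static
half (`qsDissipation_uniform_two_mul_le` of `Exactness/QuasiStaticDissipation.lean` was `r = 2`):

* `qsDissipation_uniform_mul_le` — **refining the switch never raises the floor**: for the uniform
  linear protocol, `KL_qs(c_k = k/(rn), rn steps) ≤ KL_qs(c_k = k/n, n steps)` for every `r ≥ 1`
  (antitone `⟨D⟩_c` only; no equal-drop hypothesis);
* lag bookkeeping with a constant drop `δ` and laziness `x`: `lagSeq_const_add`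
  (`e_{j+m} = x^m e_j + e_m`), `lagSeq_const_le` (`e_m ≤ m δ` for `x ≤ 1`),
  `sum_lagSeq_const_block` (`Σ_{m<r} e_{a+m} = (Σ_{m<r} x^m) e_a + Σ_{m<r} e_m`);
* the scalar inequality that drives everything, `two_mul_geom_le`:
  `2 Σ_{t<r} x^{t+1} ≤ (r − 1) + (r + 1) x^r` on `[0, 1]` (equivalently
  `Σ_{0<u<r} (1 − x^u)(1 − x^{r−u}) ≥ 0`; tight as `x → 1`), via the Bernoulli-type step
  `succ_mul_pow_le`: `(r + 1) x^r ≤ 1 + r x^{r+1}`;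
* **`sum_lagSeq_block_le`** (per block, general `r`): the fine lag `e` (drop `δ`, laziness `x`)
  against the coarse lag `E` (drop `rδ`, laziness `x^r`) obeys
  `Σ_{m<r} e_{rb+m} ≤ δ·Σ_{m<r} m + r·E_b` (`= δ r(r−1)/2 + r E_b`) for all `b`, `0 ≤ x ≤ 1`,
  `δ ≥ 0` — the `r` fine steps of block `b` lag in total by at most what the coarse step pays for
  holding a stale configuration plus `r` times the coarse lag (induction on `b`; the step is exactly
  `two_mul_geom_le` after the identity `(Σ_{m<r} x^m) e_r + (1 − x^r) Σ_{m<r} e_m = (Σ_{m<r} x^m)·x·r·δ`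
  from `sum_lagSeq_eq` and `mul_neg_geom_sum`); `sum_block_work_le` is the same in work units;
* **`lazyDissipation_refine_le`** — if the equilibrium drops of `⟨D⟩` along the fine grid `j/(rn)`
  are all equal (`= δ`), then for every `0 ≤ ε ≤ 1`
  `⟨W⟩ − ΔF [rn steps, laziness ε] ≤ ⟨W⟩ − ΔF [n steps, laziness ε^r]`:
  `r·n` switches with ONE lazy sweep each dissipate no more than `n` switches with `r` sweeps each
  (`r` sweeps of laziness `ε` ARE one layer of laziness `ε^r`: `sum_lazyLayer_mul_lazyLayer`,
  `lawAt_lazyLayer`).  `r = 2` is `lazyDissipation_halving_le`; replacing `ε` by `ε^s` gives the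
  comparison "`rn` steps × `s` sweeps versus `n` steps × `rs` sweeps".

NOT a theorem without the equal-drop hypothesis (`Exactness/LazyRelaxationGranularityWitness.lean`:
a 2-state system with a one-step drop of `⟨D⟩_c` inside `(1/4, 1/2)` has coarse < fine at
`(n, r, ε) = (2, 2, 1/2)`).  Reading (HOME/s0-cpn-nemc/RESULTS.md §12(d)/(e), §13): "buy
granularity" is exact for the quasi-static floor for every `r` (first bullet) and for the lag when
`Var_c(D)` is flat along the path (last bullet); with a localised drop the sweeps belong right after
it.  Nothing here is a claim about the heat-bath / over-relaxation kernels of the production runs.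
-/

namespace Summit.Ventures.LatticeQCDFlow.Exactness

open Finset
open Summit.Ventures.LatticeQCDFlow.Theory2

variable {X : Type*} [Fintype X]

/-! ## Block sums and casts -/

/-- `Σ_{j < r·n} f j = Σ_{b<n} Σ_{m<r} f (r b + m)` (blocks of `r` consecutive indices). -/
theorem sum_range_mul_block (f : ℕ → ℝ) (r n : ℕ) :
    ∑ j ∈ range (r * n), f j = ∑ b ∈ range n, ∑ m ∈ range r, f (r * b + m) := by
  induction n with
  | zero => simp
  | succ n ih => rw [Nat.mul_succ, sum_range_add, ih, sum_range_succ]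

/-- Telescoping over one block: `Σ_{m<r} (g (a+m+1) − g (a+m)) = g (a+r) − g a`. -/
theorem sum_range_block_telescope (g : ℕ → ℝ) (a r : ℕ) :
    ∑ m ∈ range r, (g (a + m + 1) - g (a + m)) = g (a + r) - g a := by
  induction r with
  | zero => simp
  | succ r ih => rw [sum_range_succ, ih, ← add_assoc]; ring

/-! ## Refining the switch never raises the floor (general `r`) -/

/-- **Refining the switch never raises the quasi-static floor.**  For the uniform linear protocol
the quasi-static dissipation along the `r`-fold refined grid `k/(rn)` (`rn` steps) is at most that
along `k/n` (`n` steps), for every `r ≥ 1`: block by block, the fine steps switch at couplings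
`≥ b/n`, where `⟨D⟩_c ≤ ⟨D⟩_{b/n}` (`meanD_antitone`), and the free-energy parts telescope to the
same `F((b+1)/n) − F(b/n)`. -/
theorem qsDissipation_uniform_mul_le [Nonempty X] (S₀ D : X → ℝ) {r : ℕ} (hr : r ≠ 0) (n : ℕ) :
    qsDissipation S₀ D (fun k => (k : ℝ) / (r * n)) (r * n)
      ≤ qsDissipation S₀ D (fun k => (k : ℝ) / n) n := by
  rcases Nat.eq_zero_or_pos n with rfl | hnpos
  · simp [qsDissipation]
  have hn' : (n : ℝ) ≠ 0 := Nat.cast_ne_zero.mpr hnpos.ne'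
  have hr' : (r : ℝ) ≠ 0 := Nat.cast_ne_zero.mpr hr
  have hrnpos : (0 : ℝ) < (r : ℝ) * n := by positivity
  have e1 : ∀ b : ℕ, ((r * b : ℕ) : ℝ) / (r * n) = (b : ℝ) / n := fun b => by
    push_cast
    exact mul_div_mul_left _ _ hr'
  have e2 : ∀ b : ℕ, ((r * b + r : ℕ) : ℝ) / (r * n) = ((b + 1 : ℕ) : ℝ) / n := fun b => by
    push_cast
    rw [show (r : ℝ) * b + r = r * (b + 1) by ring]
    exact mul_div_mul_left _ _ hr'
  have stepF : ∀ j : ℕ, ((j + 1 : ℕ) : ℝ) / (r * n) - (j : ℝ) / (r * n) = 1 / (r * n) :=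
    fun j => by rw [Nat.cast_succ]; ring
  have stepC : ∀ b : ℕ, ((b + 1 : ℕ) : ℝ) / n - (b : ℝ) / n = 1 / n :=
    fun b => by rw [Nat.cast_succ]; ring
  have hw0 : (0 : ℝ) ≤ 1 / (r * n) := by positivity
  have hw : (1 : ℝ) / n = r * (1 / (r * n)) := by field_simp
  unfold qsDissipation
  simp_rw [stepF, stepC]
  rw [sum_range_mul_block]
  refine sum_le_sum fun b _ => ?_
  have tel : ∑ m ∈ range r, (linFreeEnergy S₀ D (((r * b + m + 1 : ℕ) : ℝ) / (r * n))
        - linFreeEnergy S₀ D (((r * b + m : ℕ) : ℝ) / (r * n)))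
      = linFreeEnergy S₀ D (((r * b + r : ℕ) : ℝ) / (r * n))
        - linFreeEnergy S₀ D (((r * b : ℕ) : ℝ) / (r * n)) :=
    sum_range_block_telescope (fun i => linFreeEnergy S₀ D ((i : ℝ) / (r * n))) (r * b) r
  rw [sum_sub_distrib, tel, e1, e2]
  have hmono : ∀ m ∈ range r,
      meanD S₀ D (((r * b + m : ℕ) : ℝ) / (r * n)) ≤ meanD S₀ D ((b : ℝ) / n) := by
    intro m _
    rw [← e1 b]
    refine meanD_antitone S₀ D (div_le_div_of_nonneg_right ?_ hrnpos.le)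
    exact_mod_cast Nat.le_add_right (r * b) m
  have hS : ∑ m ∈ range r, 1 / ((r : ℝ) * n) * meanD S₀ D (((r * b + m : ℕ) : ℝ) / (r * n))
      ≤ 1 / (n : ℝ) * meanD S₀ D ((b : ℝ) / n) :=
    calc ∑ m ∈ range r, 1 / ((r : ℝ) * n) * meanD S₀ D (((r * b + m : ℕ) : ℝ) / (r * n))
        ≤ ∑ m ∈ range r, 1 / ((r : ℝ) * n) * meanD S₀ D ((b : ℝ) / n) :=
          sum_le_sum fun m hm => mul_le_mul_of_nonneg_left (hmono m hm) hw0
      _ = 1 / (n : ℝ) * meanD S₀ D ((b : ℝ) / n) := by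
          rw [sum_const, card_range, nsmul_eq_mul, hw]
          ring
  linarith

/-! ## The lag with a constant drop: shifting, saturation, block sums -/

/-- Constant drops: shifting the start, `e_{j+m} = x^m e_j + e_m`. -/
theorem lagSeq_const_add (x δ : ℝ) (j : ℕ) :
    ∀ m, lagSeq x (fun _ => δ) (j + m) = x ^ m * lagSeq x (fun _ => δ) j + lagSeq x (fun _ => δ) m
  | 0 => by simp
  | m + 1 => by
      rw [← add_assoc, lagSeq_succ x _ (j + m), lagSeq_const_add x δ j m, lagSeq_succ x _ m]
      ring

/-- Constant drops, `0 ≤ x ≤ 1`: the lag never exceeds the drop accumulated so far, `e_m ≤ m δ`. -/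
theorem lagSeq_const_le {x δ : ℝ} (h0 : 0 ≤ x) (h1 : x ≤ 1) (hδ : 0 ≤ δ) :
    ∀ m : ℕ, lagSeq x (fun _ => δ) m ≤ m * δ
  | 0 => by simp
  | m + 1 => by
      rw [lagSeq_succ]
      have ih := lagSeq_const_le h0 h1 hδ m
      have he := lagSeq_nonneg h0 (fun _ => hδ) m
      push_cast
      nlinarith [mul_nonneg (sub_nonneg.mpr h1) (add_nonneg he hδ)]

/-- Block sum of a constant-drop lag: `Σ_{m<r} e_{a+m} = (Σ_{m<r} x^m) e_a + Σ_{m<r} e_m`. -/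
theorem sum_lagSeq_const_block (x δ : ℝ) (r a : ℕ) :
    ∑ m ∈ range r, lagSeq x (fun _ => δ) (a + m)
      = (∑ m ∈ range r, x ^ m) * lagSeq x (fun _ => δ) a + ∑ m ∈ range r, lagSeq x (fun _ => δ) m := by
  simp_rw [lagSeq_const_add x δ a, sum_add_distrib, sum_mul]

/-! ## The scalar inequality -/

/-- Bernoulli-type step: `(r + 1) x^r ≤ 1 + r x^{r+1}` on `[0, 1]`
(`q_{r+1} = x q_r + (1 − x)(1 − x^{r+1})` for `q_r = 1 + r x^{r+1} − (r+1) x^r`). -/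
theorem succ_mul_pow_le {x : ℝ} (h0 : 0 ≤ x) (h1 : x ≤ 1) :
    ∀ r : ℕ, ((r : ℝ) + 1) * x ^ r ≤ 1 + r * x ^ (r + 1)
  | 0 => by norm_num
  | r + 1 => by
      have ih := succ_mul_pow_le h0 h1 r
      have hx1 : x ^ (r + 1) ≤ 1 := pow_le_one₀ h0 h1
      have h2 := mul_le_mul_of_nonneg_left ih h0
      have h3 := mul_nonneg (sub_nonneg.mpr h1) (sub_nonneg.mpr hx1)
      push_cast
      rw [pow_succ, pow_succ] at *
      rw [pow_succ]
      nlinarith [h2, h3, pow_nonneg h0 r]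

/-- `2 Σ_{t<r} x^{t+1} ≤ (r − 1) + (r + 1) x^r` on `[0, 1]` — equivalently
`Σ_{0<u<r} (1 − x^u)(1 − x^{r−u}) ≥ 0`; equality at `x = 1`. -/
theorem two_mul_geom_le {x : ℝ} (h0 : 0 ≤ x) (h1 : x ≤ 1) :
    ∀ r : ℕ, 2 * ∑ t ∈ range r, x ^ (t + 1) ≤ ((r : ℝ) - 1) + (r + 1) * x ^ r
  | 0 => by norm_num
  | r + 1 => by
      rw [sum_range_succ, mul_add]
      have ih := two_mul_geom_le h0 h1 r
      have hb := succ_mul_pow_le h0 h1 r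
      push_cast
      linarith

/-! ## Fine versus coarse lag, block by block -/

/-- **Per-block comparison (general `r`).**  Fine lag `e` (constant drop `δ`, laziness `x`) against
the coarse lag `E` (drop `rδ`, laziness `x^r`): for every block `b`,
`Σ_{m<r} e_{rb+m} ≤ δ·Σ_{m<r} m + r·E_b` (`Σ_{m<r} m = r(r−1)/2`; `0 ≤ x ≤ 1`, `δ ≥ 0`). -/
theorem sum_lagSeq_block_le {x δ : ℝ} (h0 : 0 ≤ x) (h1 : x ≤ 1) (hδ : 0 ≤ δ) (r b : ℕ) :
    ∑ m ∈ range r, lagSeq x (fun _ => δ) (r * b + m)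
      ≤ δ * (∑ m ∈ range r, (m : ℝ)) + r * lagSeq (x ^ r) (fun _ => (r : ℝ) * δ) b := by
  have hΦ0 : 0 ≤ ∑ m ∈ range r, x ^ m := sum_nonneg fun m _ => pow_nonneg h0 m
  have hr0 : (0 : ℝ) ≤ r := Nat.cast_nonneg r
  -- Gauss: `Σ_{m<k} m = k(k-1)/2`
  have hsm : ∀ k : ℕ, ∑ m ∈ range k, (m : ℝ) = (k : ℝ) * (k - 1) / 2 := by
    intro k
    induction k with
    | zero => simp
    | succ k ih =>
        rw [sum_range_succ, ih]
        push_cast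
        ring
  -- `C ≤ δ Σ_{m<r} m`
  have hC : ∑ m ∈ range r, lagSeq x (fun _ => δ) m ≤ δ * ∑ m ∈ range r, (m : ℝ) := by
    rw [mul_sum]
    exact sum_le_sum fun m _ => (lagSeq_const_le h0 h1 hδ m).trans_eq (mul_comm _ _)
  -- the identity `Φ e_r + (1 - x^r) C = Φ x r δ`
  have hs := sum_lagSeq_eq x (fun _ => δ) r
  simp only [sum_const, card_range, nsmul_eq_mul] at hs
  have hg : (1 - x ^ r) = (1 - x) * ∑ m ∈ range r, x ^ m := (mul_neg_geom_sum x r).symm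
  have ident : (∑ m ∈ range r, x ^ m) * lagSeq x (fun _ => δ) r
        + (1 - x ^ r) * ∑ m ∈ range r, lagSeq x (fun _ => δ) m
      = (∑ m ∈ range r, x ^ m) * (x * (r * δ)) := by
    linear_combination (∑ m ∈ range r, x ^ m) * hs
      + (∑ m ∈ range r, lagSeq x (fun _ => δ) m) * hg
  -- the key step: `Φ e_r + (1 - x^r) C ≤ (1 - x^r) δ r(r-1)/2 + r² x^r δ`
  have hxΦ : ∑ t ∈ range r, x ^ (t + 1) = x * ∑ m ∈ range r, x ^ m := by
    rw [mul_sum]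
    exact sum_congr rfl fun t _ => by ring
  have h3 := two_mul_geom_le h0 h1 r
  rw [hxΦ] at h3
  have key : (∑ m ∈ range r, x ^ m) * lagSeq x (fun _ => δ) r
        + (1 - x ^ r) * ∑ m ∈ range r, lagSeq x (fun _ => δ) m
      ≤ (1 - x ^ r) * (δ * ∑ m ∈ range r, (m : ℝ)) + (r : ℝ) ^ 2 * x ^ r * δ := by
    rw [ident, hsm r]
    have h4 := mul_le_mul_of_nonneg_left h3 (mul_nonneg hδ hr0)
    nlinarith [h4]
  -- induction on the block index for `Φ e_{rb} + C ≤ δ Σ_{m<r} m + r E_b`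
  have main : ∀ b : ℕ, (∑ m ∈ range r, x ^ m) * lagSeq x (fun _ => δ) (r * b)
        + ∑ m ∈ range r, lagSeq x (fun _ => δ) m
      ≤ δ * (∑ m ∈ range r, (m : ℝ)) + r * lagSeq (x ^ r) (fun _ => (r : ℝ) * δ) b := by
    intro b
    induction b with
    | zero =>
        simp only [lagSeq_zero, mul_zero, zero_add, add_zero]
        exact hC
    | succ b ih =>
        rw [Nat.mul_succ, lagSeq_const_add x δ (r * b) r, lagSeq_succ]
        have hxr : 0 ≤ x ^ r := pow_nonneg h0 r
        have h2 := mul_le_mul_of_nonneg_left ih hxr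
        nlinarith [h2, key]
  rw [sum_lagSeq_const_block x δ r (r * b)]
  exact main b

/-- Block `b` of the work comparison, abstract form: with the block's top equilibrium value `M`,
fine step weight `w ≥ 0` and the fine means `M − m δ`,
`Σ_{m<r} w (M − m δ + e_{rb+m}) ≤ r w (M + E_b)`. -/
theorem sum_block_work_le {x δ w M : ℝ} (h0 : 0 ≤ x) (h1 : x ≤ 1) (hδ : 0 ≤ δ) (hw : 0 ≤ w)
    (r b : ℕ) :
    ∑ m ∈ range r, w * (M - m * δ + lagSeq x (fun _ => δ) (r * b + m))
      ≤ r * w * (M + lagSeq (x ^ r) (fun _ => (r : ℝ) * δ) b) := by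
  have hblock := sum_lagSeq_block_le h0 h1 hδ r b
  have expand : ∑ m ∈ range r, w * (M - m * δ + lagSeq x (fun _ => δ) (r * b + m))
      = w * (r * M - (∑ m ∈ range r, (m : ℝ)) * δ
          + ∑ m ∈ range r, lagSeq x (fun _ => δ) (r * b + m)) := by
    rw [← mul_sum, sum_add_distrib, sum_sub_distrib, sum_const, card_range, nsmul_eq_mul,
      ← sum_mul]
  rw [expand]
  have h2 := mul_le_mul_of_nonneg_left hblock hw
  nlinarith [h2]

/-! ## Refining the switch at a fixed sweep budget -/

/-- **Granularity at a fixed sweep budget, general refinement factor (equal drops).**  For the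
linear protocol with lazy layers: if the equilibrium drops of `⟨D⟩` along the fine grid `j/(rn)` are
all equal to `δ`, then the `rn`-step protocol with ONE sweep of laziness `ε` per step dissipates no
more than the `n`-step protocol with `r` such sweeps per step (one layer of laziness `ε^r`), for
every `0 ≤ ε ≤ 1` and every `r ≥ 1`. -/
theorem lazyDissipation_refine_le [Nonempty X] [DecidableEq X] (S₀ D : X → ℝ) {r n : ℕ}
    (hr : r ≠ 0) (hn : n ≠ 0) {ε : ℝ} (h0 : 0 ≤ ε) (h1 : ε ≤ 1) {δ : ℝ}
    (hδ : ∀ j < r * n,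
      meanD S₀ D ((j : ℝ) / (r * n)) - meanD S₀ D (((j + 1 : ℕ) : ℝ) / (r * n)) = δ) :
    lazyDissipation S₀ D (fun k => (k : ℝ) / (r * n)) ε (r * n)
      ≤ lazyDissipation S₀ D (fun k => (k : ℝ) / n) (ε ^ r) n := by
  have hr' : (r : ℝ) ≠ 0 := Nat.cast_ne_zero.mpr hr
  have hn' : (n : ℝ) ≠ 0 := Nat.cast_ne_zero.mpr hn
  have hrn0 : r * n ≠ 0 := mul_ne_zero hr hn
  have hrnpos : (0 : ℝ) < (r : ℝ) * n := by positivity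
  -- the drop is non-negative
  have hδ0 : 0 ≤ δ := by
    rw [← hδ 0 (Nat.pos_of_ne_zero hrn0)]
    refine sub_nonneg.mpr (meanD_antitone S₀ D ?_)
    exact div_le_div_of_nonneg_right (by exact_mod_cast Nat.zero_le 1) hrnpos.le
  -- cast bookkeeping
  have e1 : ∀ b : ℕ, ((r * b : ℕ) : ℝ) / (r * n) = (b : ℝ) / n := fun b => by
    push_cast
    exact mul_div_mul_left _ _ hr'
  have e2 : ∀ b : ℕ, ((r * b + r : ℕ) : ℝ) / (r * n) = ((b + 1 : ℕ) : ℝ) / n := fun b => by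
    push_cast
    rw [show (r : ℝ) * b + r = r * (b + 1) by ring]
    exact mul_div_mul_left _ _ hr'
  have stepF : ∀ j : ℕ, ((j + 1 : ℕ) : ℝ) / (r * n) - (j : ℝ) / (r * n) = 1 / (r * n) :=
    fun j => by rw [Nat.cast_succ]; ring
  have stepC : ∀ b : ℕ, ((b + 1 : ℕ) : ℝ) / n - (b : ℝ) / n = 1 / n :=
    fun b => by rw [Nat.cast_succ]; ring
  have hw0 : (0 : ℝ) ≤ 1 / (r * n) := by positivity
  have hw : (1 : ℝ) / n = r * (1 / (r * n)) := by field_simp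
  -- inside each block the fine equilibrium means decrease linearly
  have hlin : ∀ b m : ℕ, r * b + m ≤ r * n →
      meanD S₀ D (((r * b + m : ℕ) : ℝ) / (r * n)) = meanD S₀ D ((b : ℝ) / n) - m * δ := by
    intro b m
    induction m with
    | zero =>
        intro _
        rw [Nat.add_zero, e1]
        simp
    | succ m ih =>
        intro hm
        have h := hδ (r * b + m) (by omega)
        have ih' := ih (by omega)
        rw [← add_assoc]
        push_cast at h ih' ⊢
        linarith
  -- the fine and the coarse lags are constant-drop lags
  have lagF : ∀ j ≤ r * n, lagSeq ε (fun i => meanD S₀ D ((i : ℝ) / (r * n))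
        - meanD S₀ D (((i + 1 : ℕ) : ℝ) / (r * n))) j = lagSeq ε (fun _ => δ) j :=
    fun j hj => lagSeq_congr ε (fun i hi => hδ i (by omega))
  have dropC : ∀ b < n,
      meanD S₀ D ((b : ℝ) / n) - meanD S₀ D (((b + 1 : ℕ) : ℝ) / n) = r * δ := by
    intro b hb
    have hrb : r * b + r ≤ r * n := by
      have h := Nat.mul_le_mul_left r hb
      rwa [Nat.mul_succ] at h
    have h := hlin b r hrb
    rw [e2] at h
    linarith
  have lagC : ∀ b ≤ n, lagSeq (ε ^ r) (fun i => meanD S₀ D ((i : ℝ) / n)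
        - meanD S₀ D (((i + 1 : ℕ) : ℝ) / n)) b = lagSeq (ε ^ r) (fun _ => (r : ℝ) * δ) b :=
    fun b hb => lagSeq_congr (ε ^ r) (fun i hi => dropC i (by omega))
  -- both dissipations as step sums
  have hF := meanWork_lazy_eq S₀ D (fun k => (k : ℝ) / (r * n)) ε (r * n)
  have hC := meanWork_lazy_eq S₀ D (fun k => (k : ℝ) / n) (ε ^ r) n
  beta_reduce at hF hC
  unfold lazyDissipation
  beta_reduce
  rw [hF, hC]
  -- endpoints of both grids coincide
  have a1 : ((r * n : ℕ) : ℝ) / (r * n) = (n : ℝ) / n := by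
    rw [div_self hn']
    push_cast
    exact div_self (mul_ne_zero hr' hn')
  have a2 : ((0 : ℕ) : ℝ) / ((r : ℝ) * n) = ((0 : ℕ) : ℝ) / (n : ℝ) := by simp
  rw [a1, a2]
  -- compare the step sums block by block
  have hsum : ∑ j ∈ range (r * n), (((j + 1 : ℕ) : ℝ) / (r * n) - (j : ℝ) / (r * n))
        * (meanD S₀ D ((j : ℝ) / (r * n)) + lagSeq ε (fun i => meanD S₀ D ((i : ℝ) / (r * n))
            - meanD S₀ D (((i + 1 : ℕ) : ℝ) / (r * n))) j)
      ≤ ∑ b ∈ range n, (((b + 1 : ℕ) : ℝ) / n - (b : ℝ) / n)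
        * (meanD S₀ D ((b : ℝ) / n) + lagSeq (ε ^ r) (fun i => meanD S₀ D ((i : ℝ) / n)
            - meanD S₀ D (((i + 1 : ℕ) : ℝ) / n)) b) := by
    simp_rw [stepF, stepC]
    rw [sum_congr rfl (fun j hj => by rw [lagF j (mem_range.mp hj).le]), sum_range_mul_block]
    refine sum_le_sum (fun b hb => ?_)
    have hbn : b < n := mem_range.mp hb
    have hrb : r * b + r ≤ r * n := by
      have h := Nat.mul_le_mul_left r hbn
      rwa [Nat.mul_succ] at h
    rw [lagC b hbn.le, hw,
      sum_congr rfl (fun m hm => by rw [hlin b m (by have := mem_range.mp hm; omega)])]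
    exact sum_block_work_le h0 h1 hδ0 hw0 r b
  linarith

end Summit.Ventures.LatticeQCDFlow.Exactness
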